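import Literature.MathematicalPhysics.QuantumLattice.PairResolventSectorSelection
import Literature.MathematicalPhysics.QuantumLattice.PlaquettePairCouplings
import HarnessLib

/-!
# Route `LevyLogBootstrap` / `AnisotropyChord`, crux `DressHalfFilled` (stmt-HubbardSuperconductivity-8148), stub 1
# `stub_plaquetteData`, certificate (W1): the SPIN-SECTOR SELECTION RULE of the plaquette pair resolvent

Support file (`--supports stmt-HubbardSuperconductivity-8148`). The certified evaluation of Kato's two-plaquette
kernel at `U = 2` (the (W1) window `0 < J`, `0 ≤ V < 2J` of the plaquette data) expands the kernel over columns of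
operator insertions `A'`, `A` (matrices whose columns are Fock vectors of ONE plaquette) as the double column sum
`Σ_{l', l} K(E; A'_{·l'}, A_{·l}; e_{l'}, e_l)` of the pair resolvent `pairResolvent` of `plaquetteHamiltonian U`
(`…PairResolventMatrixForm`). This file proves its SELECTION RULE: if every column of `A'` lies in the
`(N↑, N↓) = (a₁, b₁)` sector and every column of `A` in the `(a₂, b₂)` sector with `(a₁, b₁) ≠ (a₂, b₂)`, the sum
vanishes — term by term, by the Literature selection rule `pairResolvent_eq_zero_of_sector_ne₁₂'`
(`PairResolventSectorSelection`: the eigenprojections of the sector-preserving Hubbard Hamiltonian preserve the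
`(N↑, N↓)` sectors, Lieb 1989 Remark (2)(i), and different sectors are orthogonal). The registered sub-goal
`dressHalfFilled_w1_selectionRule` (signature verbatim as registered on the item) is the closed form.

References: W.-F. Tsai, S. A. Kivelson, PRB 73 (2006) 214510, App. A (A1) [TsaiKivelson2006]; E. H. Lieb, PRL 62
(1989) 1201, Remark (2) [Lieb1989]; T. Kato (1966) I-§5.3. No definition and no named fact is introduced; all
statements are [folklore] bookkeeping.
-/

set_option linter.dupNamespace false

noncomputable section

namespace Summit.HubbardSuperconductivity.HubbardSuperconductivity.Theorems.LevyLogBootstrap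

open Matrix Finset Literature.MathematicalPhysics.QuantumLattice

/-- **Spin-sector selection rule of the column-summed plaquette pair resolvent**: columns of `A'` in sector
`(a₁, b₁)`, columns of `A` in sector `(a₂, b₂) ≠ (a₁, b₁)` ⇒ `Σ_{l', l} K(E; A'_{·l'}, A_{·l}; e_{l'}, e_l) = 0`, for
every coupling `U` and energy `E` (any `DecidableEq` instance on the configurations).
[cite: TsaiKivelson2006, App. A (A1)] -/
theorem pairResolvent_colSum_eq_zero_of_sector_ne [DecidableEq (Finset (Orb PlaquetteSite))] (U E : ℝ)
    {a₁ b₁ a₂ b₂ : ℕ} {A' A : Matrix (Finset (Orb PlaquetteSite)) (Finset (Orb PlaquetteSite)) ℂ}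
    (hA' : ∀ l', IsInSector a₁ b₁ (fun s => A' s l')) (hA : ∀ l, IsInSector a₂ b₂ (fun s => A s l))
    (hne : (a₁, b₁) ≠ (a₂, b₂)) :
    (∑ l', ∑ l, pairResolvent (plaquetteHamiltonian_isHermitian U) E (fun i => A' i l') (fun i => A i l)
      (Pi.single l' 1) (Pi.single l 1)) = 0 :=
  Finset.sum_eq_zero fun l' _ => Finset.sum_eq_zero fun l _ =>
    pairResolvent_eq_zero_of_sector_ne₁₂' (plaquetteHamiltonian_isHermitian U)
      (LiebThm1.preservesSectors_hamiltonian plaquetteGraph 1 U) E (hA' l') (hA l) hne _ _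

/-! ### Registered form -/

set_option linter.style.longLine false in
/-- **Registered sub-goal `dressHalfFilled_w1_selectionRule`** (closed form, signature verbatim as registered on the
crux item stmt-HubbardSuperconductivity-8148): the spin-sector selection rule of the column-summed pair resolvent of
`plaquetteHamiltonian U`. [cite: TsaiKivelson2006, App. A (A1)] -/
theorem dressHalfFilled_w1_selectionRule : ∀ (U E : ℝ) {a₁ b₁ a₂ b₂ : ℕ} {A' A : Matrix (Finset (Orb PlaquetteSite)) (Finset (Orb PlaquetteSite)) ℂ}, (∀ l', IsInSector a₁ b₁ (fun s => A' s l')) → (∀ l, IsInSector a₂ b₂ (fun s => A s l)) → (a₁, b₁) ≠ (a₂, b₂) → (∑ l', ∑ l, pairResolvent (plaquetteHamiltonian_isHermitian U) E (fun i => A' i l') (fun i => A i l) (Pi.single l' 1) (Pi.single l 1)) = 0 :=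
  fun U E _ _ _ _ _ _ hA' hA hne => pairResolvent_colSum_eq_zero_of_sector_ne U E hA' hA hne

end Summit.HubbardSuperconductivity.HubbardSuperconductivity.Theorems.LevyLogBootstrap

end
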